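import Summits.ResolutionOfSingularities.ResolutionOfSingularities.Theorems.FrobeniusClosingPatchingRelPerfectMonomialRungClosed
import Summits.ResolutionOfSingularities.ResolutionOfSingularities.Theorems.FrobeniusClosingPatchingRelPerfectCoreRungClosure
import Summits.ResolutionOfSingularities.ResolutionOfSingularities.Theorems.FrobeniusClosingPatchingRelPerfectDepthPowerRung
import Summits.ResolutionOfSingularities.ResolutionOfSingularities.Theorems.FrobeniusClosingPatchingRelPerfectDepthConclusion
import HarnessLib

/-!
# Chain W5.2 — the σ-FREE closed rungs IN THE CORE'S DRESS (rung-ledger hygiene, companion of `…DepthRungsCoreDress`)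

[OURS · L1 W5.2 · rung ledger] res-L1-w52-plan-1 g9 STEER 5 (2026-08-27T11:32:42Z) (2) «CoreDress rows … — welcome now —
«monomialGeneral» (p527034 over the core binders)», res-type-003 g8.  Crux `PatchingRelPerfect` (stmt-ResolutionOfSingularities-16161),
line `closed_point_slice`, registered skeleton v5.1 (`df2071be3e11c652`); the OPEN CORE `stub_atomDimFourBlowup` has the binder list
`(p) (hp : p.Prime) (S : Type) [CommRing S] [IsRegularLocalRing S] [CharP S p] [IsAdicComplete (maximalIdeal S) S]
[PerfectField (ResidueField S)] (hdim : ringKrullDim S = (4 : ℕ)) (I : Ideal S) (hI : I ≠ ⊥) (T : Scheme.{0}) (f : T ⟶ Spec S)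
(hf : IsBlowup f (affineBlowup.idealSheaf I)) (hoff : T regular off the closed point) ⊢ ∃ J T' π, J ≠ ⊥ ∧ (supp J over the closed
point) ∧ IsBlowup π J ∧ Scheme.IsRegular T'`.

`…DepthRungsCoreDress` (p524777) dressed the five closed rungs that carry a COEFFICIENT FIELD.  This module dresses the three closed
rungs whose member classes are σ-FREE (stated in a system `x` of generators of `𝔪` only), each as «the core's binder list VERBATIM
+ the member restriction `hmem : I = …` (or a membership predicate) ⊢ the core's conclusion», by name over the tree closers:

* (6) `monomialGeneral` — R-mono GENERAL, FACT-FREE: `I = monomialSpan x A` an `𝔪`-primary MONOMIAL ideal in generators `x` of `𝔪`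
  (`DepthTargets.monomialConclusion_holds`, res-L1-w52-stub-4, p527034, companion form) through the companion ⇒ core bridge
  `atomConclusion_of_companion'` (W2, p≤493249-lineage; Stacks 080A);
* (7) `powerRung` — R-pow, modulo the two printed dimension-three facts F-31 `CossartPiltant2019Principalization` and F-32bR
  `CossartJannsenSaito2020EmbeddedSequenceB` (hypotheses): `I = 𝔞^k ⊔ J` with `𝔞 ≤ 𝔪^e`, `(x_i^{ek+k})_i ≤ J ≤ 𝔪^{ek+k}`, `k ≥ 1`
  (`DepthPow.powerRung_atom`, p≈509xxx lineage);
* (8) `depthOne` — r-d1, modulo the same two facts: `I` of exceptional depth one in `x` (`HasExceptionalDepth 1 x I`)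
  (`DepthTargets.depthConclusionPerfect_one`, which is ALREADY stated on the core's terms up to binder order).

BINDER CENSUS (numbers, not adjectives): USED by all three = `IsRegularLocalRing S` · `hdim` · `hf`; USED by (6)(7) = `hI : I ≠ ⊥`
(the companion bridge needs it); PASSED THROUGH by (8) = `PerfectField (ResidueField S)` (an explicit argument of
`DepthConclusionPerfect`, unused downstream for `ℓ = 1` per its docstring); NOT USED by any = `CharP S p` · `IsAdicComplete` · `hoff`.
FACT BUDGET unchanged: (6) fact-free; (7)(8) keep F-31 + F-32bR as hypotheses (never asserted).  OURS; compositions of tree theorems by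
name; nothing here is a statement of the manuscript under review (AI, weaker than expert review).

## References
* J. Kollár, *Lectures on Resolution of Singularities* (2007), (3.111) Step 3. [Kollar2007]
* The Stacks Project, Tag 080A (composition of blowing ups). [StacksProject]
* V. Cossart, O. Piltant, J. Algebra 529 (2019), Prop. 4.4; V. Cossart, U. Jannsen, S. Saito, LNM 2270 (2020), Thm. 1.4.
  [CossartPiltant2019] [CossartJannsenSaito2020]
-/

-- `Summit.<Summit>.<Sub>.Theorems` with `Sub = Summit` (single-conjunct summit, D-0017)
set_option linter.dupNamespace false

noncomputable section

open CategoryTheory AlgebraicGeometry IsLocalRing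
open Literature.AlgebraicGeometry.Resolution
open Summit.ResolutionOfSingularities.ResolutionOfSingularities.Theorems.DepthTargets

namespace Summit.ResolutionOfSingularities.ResolutionOfSingularities.Theorems.CoreDress

/-! ## §6 Rung (6): `𝔪`-primary MONOMIAL ideals (R-mono GENERAL, fact-free) -/

/-- **Core dress of R-mono GENERAL** (`DepthTargets.monomialConclusion_holds`, p527034, FACT-FREE): the open core's conclusion for
its binder list VERBATIM, restricted to the `𝔪`-primary MONOMIAL ideals `I = monomialSpan x A` (`A` a non-empty finite set of
exponent vectors, `𝔪^N ≤ I`) in a system `x = (x₀,…,x₃)` of generators of `𝔪`.  Route: companion form (an `𝔪`-primary `Q` with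
`Bl_{I·Q}` regular) ⇒ blow-up form by `atomConclusion_of_companion'`.  Uses: regular local, `hdim`, `hI`, `hf`; does NOT use `CharP`,
completeness, `PerfectField`, `hoff`. [cite: Kollar2007, (3.111) Step 3] [cite: StacksProject, Tag 080A] -/
theorem monomialGeneral (p : ℕ) (_hp : p.Prime)
    (S : Type) [CommRing S] [IsRegularLocalRing S] [CharP S p]
    [IsAdicComplete (IsLocalRing.maximalIdeal S) S] [PerfectField (IsLocalRing.ResidueField S)]
    (hdim : ringKrullDim S = (4 : ℕ)) (I : Ideal S) (hI : I ≠ ⊥) (T : Scheme.{0})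
    (f : T ⟶ Spec (.of S)) (hf : IsBlowup f (affineBlowup.idealSheaf I))
    (_hoff : ∀ t : T, f.base t ≠ IsLocalRing.closedPoint S → IsRegularLocalRing (T.presheaf.stalk t))
    -- the member restriction
    (x : Fin 4 → S) (hx : Ideal.span (Set.range x) = IsLocalRing.maximalIdeal S)
    (A : Finset (Fin 4 → ℕ)) (hA : A.Nonempty) (N : ℕ) (hN : IsLocalRing.maximalIdeal S ^ N ≤ monomialSpan x A)
    (hmem : I = monomialSpan x A) :
    ∃ (J : T.IdealSheafData) (T' : Scheme.{0}) (π : T' ⟶ T), J ≠ ⊥ ∧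
      (∀ t : T, t ∈ J.support → f.base t = IsLocalRing.closedPoint S) ∧
      IsBlowup π J ∧ Scheme.IsRegular T' := by
  subst hmem
  exact atomConclusion_of_companion' hI (monomialConclusion_holds S 4 x hx hdim.symm A hA N hN) T f hf

/-! ## §7 Rung (7): the POWER rung `I = 𝔞^k + J` (R-pow, modulo F-31 + F-32bR) -/

/-- **Core dress of R-pow** (`DepthPow.powerRung_atom`, modulo the printed dimension-three facts F-31
`CossartPiltant2019Principalization` and F-32bR `CossartJannsenSaito2020EmbeddedSequenceB`, both HYPOTHESES): the open core's
conclusion for its binder list VERBATIM, restricted to the members `I = 𝔞^k ⊔ J` with `𝔞 ≤ 𝔪^e`, `(x_i^{ek+k})_i ≤ J ≤ 𝔪^{ek+k}`,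
`k ≥ 1`, in generators `x` of `𝔪` (the headline sub-family `(F^k) + 𝔪^{ek+k}`, `F ∈ 𝔪^e`, included).  Uses: regular local, `hdim`,
`hI`, `hf`; not `CharP`, completeness, `PerfectField`, `hoff`. [cite: CossartPiltant2019, Prop. 4.4]
[cite: CossartJannsenSaito2020, Thm. 1.4] [cite: StacksProject, Tag 080A] -/
theorem powerRung (hCP : CossartPiltant2019Principalization.{0}) (hCJS : CossartJannsenSaito2020EmbeddedSequenceB.{0})
    (p : ℕ) (_hp : p.Prime)
    (S : Type) [CommRing S] [IsRegularLocalRing S] [CharP S p]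
    [IsAdicComplete (IsLocalRing.maximalIdeal S) S] [PerfectField (IsLocalRing.ResidueField S)]
    (hdim : ringKrullDim S = (4 : ℕ)) (I : Ideal S) (hI : I ≠ ⊥) (T : Scheme.{0})
    (f : T ⟶ Spec (.of S)) (hf : IsBlowup f (affineBlowup.idealSheaf I))
    (_hoff : ∀ t : T, f.base t ≠ IsLocalRing.closedPoint S → IsRegularLocalRing (T.presheaf.stalk t))
    -- the member restriction
    (x : Fin 4 → S) (hx : Ideal.span (Set.range x) = IsLocalRing.maximalIdeal S)
    (k e : ℕ) (hk : 1 ≤ k) (𝔞 J : Ideal S) (h𝔞 : 𝔞 ≤ IsLocalRing.maximalIdeal S ^ e)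
    (hJ₁ : Ideal.span (Set.range fun i => x i ^ (e * k + k)) ≤ J) (hJ₂ : J ≤ IsLocalRing.maximalIdeal S ^ (e * k + k))
    (hmem : I = 𝔞 ^ k ⊔ J) :
    ∃ (J' : T.IdealSheafData) (T' : Scheme.{0}) (π : T' ⟶ T), J' ≠ ⊥ ∧
      (∀ t : T, t ∈ J'.support → f.base t = IsLocalRing.closedPoint S) ∧
      IsBlowup π J' ∧ Scheme.IsRegular T' :=
  DepthPow.powerRung_atom hCP hCJS S hdim x hx k e hk 𝔞 J h𝔞 hJ₁ hJ₂ I hmem hI T f hf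

/-! ## §8 Rung (8): exceptional depth ONE (r-d1, modulo F-31 + F-32bR) -/

/-- **Core dress of r-d1** (`DepthTargets.depthConclusionPerfect_one`, modulo F-31 + F-32bR as HYPOTHESES): the open core's
conclusion for its binder list VERBATIM, restricted to the ideals of EXCEPTIONAL DEPTH ONE in generators `x` of `𝔪`
(`HasExceptionalDepth 1 x I`: `I ≤ 𝔪^d` and every `x_i^{d+1} ∈ I` for some `d`).  Uses: regular local, `hdim`, `hI`, `hf`; passes the
core's `PerfectField` binder through to `DepthConclusionPerfect 1` (unused there for `ℓ = 1`); not `CharP`, completeness, `hoff`.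
[cite: CossartPiltant2019, Prop. 4.4] [cite: CossartJannsenSaito2020, Thm. 1.4, Thm. 6.9 (a)] [cite: Kollar2007, (3.111) Step 3] -/
theorem depthOne (hCP : CossartPiltant2019Principalization.{0}) (hCJS : CossartJannsenSaito2020EmbeddedSequenceB.{0})
    (p : ℕ) (_hp : p.Prime)
    (S : Type) [CommRing S] [IsRegularLocalRing S] [CharP S p]
    [IsAdicComplete (IsLocalRing.maximalIdeal S) S] [PerfectField (IsLocalRing.ResidueField S)]
    (hdim : ringKrullDim S = (4 : ℕ)) (I : Ideal S) (hI : I ≠ ⊥) (T : Scheme.{0})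
    (f : T ⟶ Spec (.of S)) (hf : IsBlowup f (affineBlowup.idealSheaf I))
    (_hoff : ∀ t : T, f.base t ≠ IsLocalRing.closedPoint S → IsRegularLocalRing (T.presheaf.stalk t))
    -- the member restriction
    (x : Fin 4 → S) (hx : Ideal.span (Set.range x) = IsLocalRing.maximalIdeal S)
    (hmem : HasExceptionalDepth 1 x I) :
    ∃ (J : T.IdealSheafData) (T' : Scheme.{0}) (π : T' ⟶ T), J ≠ ⊥ ∧
      (∀ t : T, t ∈ J.support → f.base t = IsLocalRing.closedPoint S) ∧
      IsBlowup π J ∧ Scheme.IsRegular T' :=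
  depthConclusionPerfect_one hCP hCJS S hdim inferInstance 4 x hx I hI hmem T f hf

end Summit.ResolutionOfSingularities.ResolutionOfSingularities.Theorems.CoreDress

end
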